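import Summits.AnomalousDissipation.AnomalousDissipation.Theses.KolmogorovPincer
import Literature.Analysis.FluidPDE.LerayHopfSpectralMeasurability
import Literature.Analysis.FluidPDE.LerayHopfTimeSliceTorus
import Literature.Analysis.FunctionSpaces.BesovDifference
import Literature.Analysis.FunctionSpaces.BesovSliceMeasurability
import Literature.Analysis.FunctionSpaces.TorusSobolevL6Spectral
import Literature.Analysis.FunctionSpaces.FlatTorus

/-!
# Support item `KolmogorovPincer.BesovSignalMeasurableTG` (stmt-AnomalousDissipation-32778), proved

Route `KolmogorovPincer` (decomp-ad cell): the S–M JUNK-NEUTRALISER of the Y-jaw.  Along every global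
Leray–Hopf solution `u` on `T³` (any force, any datum) the Besov signal
`t ↦ ([u(t)]²_{B^{1/2}_{8/3,∞}}).toReal` is a.e.-strongly measurable on `(0,∞)`: a.e. time slice lies in
`L^p` for `p ≤ 6` (`L²_t H¹_x` clause + the spectral embedding `H¹(T³) ⊂ L⁶(T³)`, tree
`Torus.exists_eLpNorm_six_le_eSobolevNorm_one`), and on each `(0,n)` the Nikol'skii sup-seminorm of a
jointly measurable field is a.e.-measurable in time (tree `Torus.aemeasurable_eBesovSupSeminorm_slice`).
Ported by name from the decomp-ad lens-1 g14/g15 node files (`CeilingLadder.lean`,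
`KolmogorovLagCut.lean`, kernel-checked 2026-08-30); landed by the cell's prover seat.  Nothing here
proves the summit or either jaw. [folklore]
-/

set_option linter.dupNamespace false

noncomputable section

namespace Summit.AnomalousDissipation.AnomalousDissipation.Theorems.KolmogorovPincerBesovSignalMeasurableTG

open scoped BigOperators Topology Classical MeasureTheory InnerProductSpace
open Filter Set Function TopologicalSpace MeasureTheory
open scoped ENNReal
open Literature.Analysis.FunctionSpaces Literature.Analysis.FluidPDE
open Summit.AnomalousDissipation.AnomalousDissipation.Theses

/-- A.e. time slice of a Leray–Hopf solution on `T³` lies in `L^p` for every `p ≤ 6`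
(`L²_t H¹_x` clause + the spectral Sobolev embedding `H¹(T³) ⊂ L⁶(T³)`). -/
theorem ae_memLp_of_isLerayHopfOn {ν T : ℝ} {F : ℝ → UnitAddTorus (Fin 3) → EuclideanSpace ℝ (Fin 3)}
    {u₀ : UnitAddTorus (Fin 3) → EuclideanSpace ℝ (Fin 3)}
    {u : ℝ → UnitAddTorus (Fin 3) → EuclideanSpace ℝ (Fin 3)} (hu : Torus.IsLerayHopfOn T ν F u₀ u)
    {p : ℝ≥0∞} (hp : p ≤ 6) :
    ∀ᵐ t ∂(volume.restrict (Set.Ioo 0 T)), MemLp (u t) p volume := by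
  obtain ⟨K, hK⟩ := Torus.exists_eLpNorm_six_le_eSobolevNorm_one (d := Fin 3) (by simp)
  filter_upwards [hu.memL2Sobolev.1] with t ht
  exact (hK (u t) ht).1.mono_exponent hp

/-- Along a global Leray–Hopf solution on `T³`, `t ↦ [u(t)]_{B^s_{p,∞}}` is a.e.-measurable on
`(0, ∞)` for `1 ≤ p ≤ 6` (tree `Torus.aemeasurable_eBesovSupSeminorm_slice` on each `(0, n)`). -/
theorem aemeasurable_eBesovSupSeminorm_of_isGlobalLerayHopf {ν : ℝ}
    {F : ℝ → UnitAddTorus (Fin 3) → EuclideanSpace ℝ (Fin 3)}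
    {u₀ : UnitAddTorus (Fin 3) → EuclideanSpace ℝ (Fin 3)}
    {u : ℝ → UnitAddTorus (Fin 3) → EuclideanSpace ℝ (Fin 3)} (hu : Torus.IsGlobalLerayHopf ν F u₀ u)
    (s : ℝ) {p : ℝ≥0∞} (hp : 1 ≤ p) (hp6 : p ≤ 6) :
    AEMeasurable (fun t => eBesovSupSeminorm s p (u t) volume) (volume.restrict (Set.Ioi (0 : ℝ))) := by
  rw [Torus.Ioi_zero_eq_iUnion_Ioo_nat, aemeasurable_iUnion_iff]
  intro n
  rcases Nat.eq_zero_or_pos n with hn | hn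
  · subst hn; simp
  · have hLH := hu n (by exact_mod_cast hn)
    have hp' : p ≠ ∞ := ne_top_of_le_ne_top (by norm_num) hp6
    exact Torus.aemeasurable_eBesovSupSeminorm_slice hp hp' hLH.aestronglyMeasurable_uncurry
      (ae_memLp_of_isLerayHopfOn hLH hp6)


/-- **Route decl `KolmogorovPincer.BesovSignalMeasurableTG` (stmt-AnomalousDissipation-32778), proved**
(for every force and datum, not only `f_TG` from rest). [folklore] -/
theorem kolmogorovPincer_besovSignalMeasurableTG : KolmogorovPincer.BesovSignalMeasurableTG := by
  intro f _ ν _ u hu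
  have h1 : (1 : ℝ≥0∞) ≤ 8 / 3 := by
    rw [ENNReal.le_div_iff_mul_le (by norm_num) (by norm_num)]; norm_num
  have h2 : (8 / 3 : ℝ≥0∞) ≤ 6 := by
    rw [ENNReal.div_le_iff_le_mul (by norm_num) (by norm_num)]; norm_num
  have h := aemeasurable_eBesovSupSeminorm_of_isGlobalLerayHopf hu (1 / 2 : ℝ) h1 h2
  exact (h.pow_const 2).ennreal_toReal.aestronglyMeasurable

end Summit.AnomalousDissipation.AnomalousDissipation.Theorems.KolmogorovPincerBesovSignalMeasurableTG
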